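import Mathlib
import Literature.Probability.Percolation.DiagonalStripJunction
import Literature.Probability.Percolation.DiagonalStripTLAction
import Literature.Probability.Percolation.DiagonalStripLumping
import Literature.Probability.Percolation.DiagonalStripStationary
import HarnessLib

/-!
# The junction functional and the Temperley–Lieb moves: self-adjointness away from the marked site

Topic `Literature/Probability/Percolation`. In the proof of Prop. 4.1 of Ikhlef–Ponsaing
(J. Stat. Phys. 149 (2012), arXiv:1202.5476) — symmetry of the first-site passage probability
`P_b = ⟨Ψ|ρ|Ψ⟩/⟨Ψ|Ψ⟩` in the unmarked rapidities — the combinatorial input is "an `Ř`-matrix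
acting between sites `i ≠ 1` and `i+1` commutes with `ρ`". In the cluster language of the named
fact `IkhlefPonsaingFirstPassage` (`ρ = ipJunction m j`, `DiagonalStripJunction.lean`; the
Temperley–Lieb moves `cpJoin`, `cpIsolate`, lumping `lump`) this file proves:

* `ipJunction_symm`, `ipJunction_lump_left/right` — `J` is symmetric and blind to lumping;
* `ipJunction_cpJoin_left_eq_right` — `J(join_{ab} Q, Q') = J(Q, join_{ab} Q')` (valid patterns);
* `ipJunction_cpIsolate_left_eq_right` — `J(iso_b Q, Q') = J(Q, iso_b Q')` for valid patterns and
  every UNMARKED site `b ≠ j` (the key step `flagReach_cpIsolate_left`: with the left pattern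
  isolated at `b`, a site glued to a flag reaches a flag avoiding `b`, because consecutive right
  steps through `b` compose inside the equivalence relation of the valid right pattern);
* `sum_pushforward_junction_comm` — the fibre-sum ("`⟨e u, v⟩_J = ⟨u, e v⟩_J`") form used with
  the lumped kernels of `DiagonalStripTransferInterlacingTwoRow.lean`.

(For the marked site `b = j` the isolation is NOT self-adjoint — this is why `P_b` is symmetric
only in the unmarked rapidities.)

## References

* Y. Ikhlef, A. K. Ponsaing, *Finite-size left-passage probability in percolation*, J. Stat. Phys.
  149 (2012) 10–36, arXiv:1202.5476, Def. 4.1, Prop. 4.1. [IkhlefPonsaing2012]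
-/

namespace Literature.Probability.Percolation

open Finset Relation Literature.Probability.LatticeModels

variable {m : ℕ}

/-! ### The glued closure -/

section Glue

/-- The glued relation of two column patterns. [folklore] -/
def glueRel (Q Q' : ColPattern m) (x y : Fin (m + 1)) : Prop := Q.1 x y = true ∨ Q'.1 x y = true

/-- `ipJunction` through the glued closure. [folklore] -/
theorem ipJunction_eq_true_iff (j : Fin (m + 1)) (Q Q' : ColPattern m) :
    ipJunction m j Q Q' = true ↔ ∃ f, EqvGen (glueRel Q Q') j f ∧ (Q.2 f = true ∨ Q'.2 f = true) := by
  simp only [ipJunction, decide_eq_true_eq]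
  rfl

/-- **`J` is symmetric.** [folklore] -/
theorem ipJunction_symm (j : Fin (m + 1)) (Q Q' : ColPattern m) : ipJunction m j Q Q' = ipJunction m j Q' Q := by
  rw [Bool.eq_iff_iff, ipJunction_eq_true_iff, ipJunction_eq_true_iff]
  have h : glueRel Q Q' = glueRel Q' Q := by
    funext x y; simp only [glueRel, eq_iff_iff]; exact Or.comm
  simp only [h, Or.comm (a := Q.2 _ = true)]

/-- Monotonicity of the junction in the glued relation and the flags. [folklore] -/
theorem ipJunction_mono {j : Fin (m + 1)} {Q₁ Q₁' Q₂ Q₂' : ColPattern m}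
    (hrel : ∀ x y, glueRel Q₁ Q₁' x y → EqvGen (glueRel Q₂ Q₂') x y)
    (hflag : ∀ f, (Q₁.2 f = true ∨ Q₁'.2 f = true) → ∃ f', EqvGen (glueRel Q₂ Q₂') f f' ∧ (Q₂.2 f' = true ∨ Q₂'.2 f' = true))
    (h : ipJunction m j Q₁ Q₁' = true) : ipJunction m j Q₂ Q₂' = true := by
  rw [ipJunction_eq_true_iff] at h ⊢
  obtain ⟨f, hf, hfl⟩ := h
  obtain ⟨f', hf', hfl'⟩ := hflag f hfl
  exact ⟨f', (EqvGen.is_equivalence _).trans (eqvGen_le_eqvGen hrel _ _ hf) hf', hfl'⟩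

/-- **`J` is blind to lumping** (left argument). [folklore] -/
theorem ipJunction_lump_left (j : Fin (m + 1)) (Q Q' : ColPattern m) :
    ipJunction m j (lump Q) Q' = ipJunction m j Q Q' := by
  rw [Bool.eq_iff_iff]
  constructor
  · -- a lumping edge joins two flagged sites: stop at the first one
    intro h
    rw [ipJunction_eq_true_iff] at h ⊢
    obtain ⟨f, hf, hfl⟩ := h
    rw [lump_snd] at hfl
    -- the set of sites glued (without lumping) to a flag is closed under the lumped glue steps
    suffices key : ∀ x y, EqvGen (glueRel (lump Q) Q') x y →
        ((∃ f, EqvGen (glueRel Q Q') x f ∧ (Q.2 f = true ∨ Q'.2 f = true)) ↔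
          (∃ f, EqvGen (glueRel Q Q') y f ∧ (Q.2 f = true ∨ Q'.2 f = true))) by
      exact ((key j f hf).2 ⟨f, EqvGen.refl _, hfl⟩)
    have step : ∀ x y, glueRel (lump Q) Q' x y →
        (∃ f, EqvGen (glueRel Q Q') x f ∧ (Q.2 f = true ∨ Q'.2 f = true)) →
          (∃ f, EqvGen (glueRel Q Q') y f ∧ (Q.2 f = true ∨ Q'.2 f = true)) := by
      rintro x y hxy ⟨f, hf, hfl⟩
      rcases hxy with h | h
      · rw [lump_fst_eq_true_iff] at h
        rcases h with h | ⟨-, hy⟩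
        · exact ⟨f, (EqvGen.is_equivalence _).trans (EqvGen.symm _ _ (EqvGen.rel _ _ (Or.inl h))) hf, hfl⟩
        · exact ⟨y, EqvGen.refl _, Or.inl hy⟩
      · exact ⟨f, (EqvGen.is_equivalence _).trans (EqvGen.symm _ _ (EqvGen.rel _ _ (Or.inr h))) hf, hfl⟩
    intro x y hxy
    induction hxy with
    | rel x y h =>
      constructor
      · exact step x y h
      · -- reverse step: glue `y` back to `x` through the same edge
        rintro ⟨f, hf, hfl⟩
        rcases h with h | h
        · rw [lump_fst_eq_true_iff] at h
          rcases h with h | ⟨hx, -⟩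
          · exact ⟨f, (EqvGen.is_equivalence _).trans (EqvGen.rel _ _ (Or.inl h)) hf, hfl⟩
          · exact ⟨x, EqvGen.refl _, Or.inl hx⟩
        · exact ⟨f, (EqvGen.is_equivalence _).trans (EqvGen.rel _ _ (Or.inr h)) hf, hfl⟩
    | refl x => exact Iff.rfl
    | symm x y _ ih => exact ih.symm
    | trans x y z _ _ ih1 ih2 => exact ih1.trans ih2
  · intro h
    refine ipJunction_mono (fun x y hxy => EqvGen.rel _ _ ?_) (fun f hf => ⟨f, EqvGen.refl _, ?_⟩) h
    · rcases hxy with h | h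
      · exact Or.inl ((lump_fst_eq_true_iff Q x y).2 (Or.inl h))
      · exact Or.inr h
    · rwa [lump_snd]

/-- `J` is blind to lumping (right argument). [folklore] -/
theorem ipJunction_lump_right (j : Fin (m + 1)) (Q Q' : ColPattern m) :
    ipJunction m j Q (lump Q') = ipJunction m j Q Q' := by
  rw [ipJunction_symm, ipJunction_lump_left, ipJunction_symm]

end Glue

/-! ### Joins are self-adjoint -/

section Join

/-- The glued closure after a join on the left contains the join edge and both patterns. [folklore] -/
theorem eqvGen_glue_cpJoin_iff (a b : Fin (m + 1)) (Q Q' : ColPattern m) (hQ : IsValid 0 Q) (x y : Fin (m + 1)) :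
    EqvGen (glueRel (cpJoin a b Q) Q') x y ↔ EqvGen (fun x y => glueRel Q Q' x y ∨ (x = a ∧ y = b)) x y := by
  apply eqvGen_iff_eqvGen
  · intro x y h
    rcases h with h | h
    · rw [cpJoin_fst_eq_true_iff] at h
      rcases h with h | ⟨h1, h2⟩ | ⟨h1, h2⟩
      · exact EqvGen.rel _ _ (Or.inl (Or.inl h))
      · -- x ~ a, b ~ y
        exact (EqvGen.is_equivalence _).trans (EqvGen.rel _ _ (Or.inl (Or.inl h1)))
          ((EqvGen.is_equivalence _).trans (EqvGen.rel _ _ (Or.inr ⟨rfl, rfl⟩)) (EqvGen.rel _ _ (Or.inl (Or.inl h2))))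
      · exact (EqvGen.is_equivalence _).trans (EqvGen.rel _ _ (Or.inl (Or.inl h1)))
          ((EqvGen.is_equivalence _).trans (EqvGen.symm _ _ (EqvGen.rel _ _ (Or.inr ⟨rfl, rfl⟩)))
            (EqvGen.rel _ _ (Or.inl (Or.inl h2))))
    · exact EqvGen.rel _ _ (Or.inl (Or.inr h))
  · intro x y h
    rcases h with (h | h) | ⟨rfl, rfl⟩
    · exact EqvGen.rel _ _ (Or.inl ((cpJoin_fst_eq_true_iff a b Q x y).2 (Or.inl h)))
    · exact EqvGen.rel _ _ (Or.inr h)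
    · exact EqvGen.rel _ _ (Or.inl ((cpJoin_fst_eq_true_iff x y Q x y).2 (Or.inr (Or.inl ⟨hQ.refl x, hQ.refl y⟩))))

/-- The junction after a join on the left, through the enlarged glue. [folklore] -/
theorem ipJunction_cpJoin_left_iff (j a b : Fin (m + 1)) (Q Q' : ColPattern m) (hQ : IsValid 0 Q) :
    ipJunction m j (cpJoin a b Q) Q' = true ↔
      ∃ f, EqvGen (fun x y => glueRel Q Q' x y ∨ (x = a ∧ y = b)) j f ∧ (Q.2 f = true ∨ Q'.2 f = true) := by
  rw [ipJunction_eq_true_iff]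
  constructor
  · rintro ⟨f, hf, hfl⟩
    rw [eqvGen_glue_cpJoin_iff a b Q Q' hQ] at hf
    rcases hfl with h | h
    · rw [cpJoin_snd_eq_true_iff] at h
      rcases h with h | ⟨h1, h2⟩ | ⟨h1, h2⟩
      · exact ⟨f, hf, Or.inl h⟩
      · refine ⟨b, (EqvGen.is_equivalence _).trans hf ((EqvGen.is_equivalence _).trans
          (EqvGen.rel _ _ (Or.inl (Or.inl h1))) (EqvGen.rel _ _ (Or.inr ⟨rfl, rfl⟩))), Or.inl h2⟩
      · refine ⟨a, (EqvGen.is_equivalence _).trans hf ((EqvGen.is_equivalence _).trans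
          (EqvGen.rel _ _ (Or.inl (Or.inl h1))) (EqvGen.symm _ _ (EqvGen.rel _ _ (Or.inr ⟨rfl, rfl⟩)))), Or.inl h2⟩
    · exact ⟨f, hf, Or.inr h⟩
  · rintro ⟨f, hf, hfl⟩
    refine ⟨f, (eqvGen_glue_cpJoin_iff a b Q Q' hQ j f).2 hf, ?_⟩
    rcases hfl with h | h
    · exact Or.inl ((cpJoin_snd_eq_true_iff a b Q f).2 (Or.inl h))
    · exact Or.inr h

/-- **Joins are self-adjoint for the junction**: `J(join_{ab} Q, Q') = J(Q, join_{ab} Q')`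
(valid patterns). [cite: IkhlefPonsaing2012, Prop. 4.1] -/
theorem ipJunction_cpJoin_left_eq_right (j a b : Fin (m + 1)) {Q Q' : ColPattern m} (hQ : IsValid 0 Q)
    (hQ' : IsValid 0 Q') : ipJunction m j (cpJoin a b Q) Q' = ipJunction m j Q (cpJoin a b Q') := by
  rw [Bool.eq_iff_iff, ipJunction_cpJoin_left_iff j a b Q Q' hQ, ipJunction_symm,
    ipJunction_cpJoin_left_iff j a b Q' Q hQ']
  have h : (fun x y => glueRel Q Q' x y ∨ (x = a ∧ y = b)) = fun x y => glueRel Q' Q x y ∨ (x = a ∧ y = b) := by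
    funext x y; simp only [glueRel, eq_iff_iff]; tauto
  simp only [h, Or.comm (a := Q.2 _ = true)]

end Join

/-! ### Isolations of unmarked sites are self-adjoint -/

section Isolate

/-- The glued relation with the left pattern isolated at `b`: old glue steps away from `b`, and the
right pattern's steps. [folklore] -/
theorem glueRel_cpIsolate_left_iff (b : Fin (m + 1)) (Q Q' : ColPattern m) (x y : Fin (m + 1)) :
    glueRel (cpIsolate b Q) Q' x y ↔ x = y ∨ (x ≠ b ∧ y ≠ b ∧ Q.1 x y = true) ∨ Q'.1 x y = true := by
  simp only [glueRel, cpIsolate_fst_eq_true_iff, or_assoc]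

/-- The `b`-deleted glue. [folklore] -/
def glueDel (b : Fin (m + 1)) (Q Q' : ColPattern m) (x y : Fin (m + 1)) : Prop :=
  x ≠ b ∧ y ≠ b ∧ glueRel Q Q' x y

/-- Sites joined to a flag other than through `b`. [folklore] -/
def flagReachDel (b : Fin (m + 1)) (Q Q' : ColPattern m) (x : Fin (m + 1)) : Prop :=
  ∃ f, f ≠ b ∧ EqvGen (glueDel b Q Q') x f ∧ (Q.2 f = true ∨ Q'.2 f = true)

/-- `flagReachDel` is a union of `glueDel`-classes. [folklore] -/
theorem flagReachDel_of_eqvGen {b : Fin (m + 1)} {Q Q' : ColPattern m} {x y : Fin (m + 1)}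
    (hxy : EqvGen (glueDel b Q Q') x y) (hy : flagReachDel b Q Q' y) : flagReachDel b Q Q' x := by
  obtain ⟨f, hfb, hf, hfl⟩ := hy
  exact ⟨f, hfb, (EqvGen.is_equivalence _).trans hxy hf, hfl⟩

/-- **Key step**: with the left pattern isolated at `b` (`Q'` valid), every site glued to a flag is
`b` itself or reaches a flag avoiding `b`. [folklore] -/
theorem flagReach_cpIsolate_left {b : Fin (m + 1)} {Q Q' : ColPattern m} (hQ' : IsValid 0 Q')
    {x f : Fin (m + 1)} (hxf : EqvGen (glueRel (cpIsolate b Q) Q') x f)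
    (hfl : (cpIsolate b Q).2 f = true ∨ Q'.2 f = true) (hx : x ≠ b) : flagReachDel b Q Q' x := by
  -- the invariant set `U`
  let U : Fin (m + 1) → Prop := fun x =>
    (x ≠ b ∧ flagReachDel b Q Q' x) ∨ (x = b ∧ (Q'.2 b = true ∨ ∃ y, y ≠ b ∧ Q'.1 b y = true ∧ flagReachDel b Q Q' y))
  -- one glue step preserves `U` (forward direction)
  have fwd : ∀ x y, glueRel (cpIsolate b Q) Q' x y → U x → U y := by
    intro x y hxy hUx
    rw [glueRel_cpIsolate_left_iff] at hxy
    rcases hxy with rfl | ⟨hxb, hyb, h⟩ | h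
    · exact hUx
    · -- an old left step away from `b`
      rcases hUx with ⟨-, hx⟩ | ⟨hxb', -⟩
      · exact Or.inl ⟨hyb, flagReachDel_of_eqvGen (EqvGen.symm _ _ (EqvGen.rel _ _ ⟨hxb, hyb, Or.inl h⟩)) hx⟩
      · exact absurd hxb' hxb
    · -- a right step `Q'.1 x y`
      by_cases hyb : y = b
      · subst hyb
        rcases hUx with ⟨hxb, hx⟩ | ⟨rfl, h'⟩
        · exact Or.inr ⟨rfl, Or.inr ⟨x, hxb, hQ'.symm _ _ h, hx⟩⟩
        · exact Or.inr ⟨rfl, h'⟩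
      · rcases hUx with ⟨hxb, hx⟩ | ⟨rfl, h'⟩
        · exact Or.inl ⟨hyb, flagReachDel_of_eqvGen (EqvGen.symm _ _ (EqvGen.rel _ _ ⟨hxb, hyb, Or.inr h⟩)) hx⟩
        · rcases h' with hfl | ⟨y₀, hy₀b, hy₀, hy₀r⟩
          · -- `b` flagged on the right: so is `y`
            exact Or.inl ⟨hyb, ⟨y, hyb, EqvGen.refl _, Or.inr (hQ'.wall _ _ h hfl)⟩⟩
          · -- go `y₀ ~ b ~ y` inside `Q'`
            have hyy₀ : Q'.1 y y₀ = true := hQ'.trans _ _ _ (hQ'.symm _ _ h) hy₀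
            exact Or.inl ⟨hyb, flagReachDel_of_eqvGen (EqvGen.rel _ _ ⟨hyb, hy₀b, Or.inr hyy₀⟩) hy₀r⟩
  -- and backward (the generating steps are symmetric up to the same case analysis)
  have bwd : ∀ x y, glueRel (cpIsolate b Q) Q' x y → U y → U x := by
    intro x y hxy hUy
    rw [glueRel_cpIsolate_left_iff] at hxy
    rcases hxy with rfl | ⟨hxb, hyb, h⟩ | h
    · exact hUy
    · rcases hUy with ⟨-, hy⟩ | ⟨hyb', -⟩
      · exact Or.inl ⟨hxb, flagReachDel_of_eqvGen (EqvGen.rel _ _ ⟨hxb, hyb, Or.inl h⟩) hy⟩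
      · exact absurd hyb' hyb
    · by_cases hxb : x = b
      · subst hxb
        rcases hUy with ⟨hyb, hy⟩ | ⟨rfl, h'⟩
        · exact Or.inr ⟨rfl, Or.inr ⟨y, hyb, h, hy⟩⟩
        · exact Or.inr ⟨rfl, h'⟩
      · rcases hUy with ⟨hyb, hy⟩ | ⟨rfl, h'⟩
        · exact Or.inl ⟨hxb, flagReachDel_of_eqvGen (EqvGen.rel _ _ ⟨hxb, hyb, Or.inr h⟩) hy⟩
        · rcases h' with hfl | ⟨y₀, hy₀b, hy₀, hy₀r⟩
          · exact Or.inl ⟨hxb, ⟨x, hxb, EqvGen.refl _, Or.inr (hQ'.wall _ _ (hQ'.symm _ _ h) hfl)⟩⟩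
          · have hxy₀ : Q'.1 x y₀ = true := hQ'.trans _ _ _ h hy₀
            exact Or.inl ⟨hxb, flagReachDel_of_eqvGen (EqvGen.rel _ _ ⟨hxb, hy₀b, Or.inr hxy₀⟩) hy₀r⟩
  have hU : ∀ x y, EqvGen (glueRel (cpIsolate b Q) Q') x y → (U x ↔ U y) := by
    intro x y hxy
    induction hxy with
    | rel x y h => exact ⟨fwd x y h, bwd x y h⟩
    | refl x => exact Iff.rfl
    | symm x y _ ih => exact ih.symm
    | trans x y z _ _ ih1 ih2 => exact ih1.trans ih2
  -- `f` is in `U`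
  have hUf : U f := by
    by_cases hfb : f = b
    · subst hfb
      rcases hfl with h | h
      · rw [cpIsolate_snd_eq_true_iff] at h; exact absurd rfl h.1
      · exact Or.inr ⟨rfl, Or.inl h⟩
    · refine Or.inl ⟨hfb, f, hfb, EqvGen.refl _, ?_⟩
      rcases hfl with h | h
      · rw [cpIsolate_snd_eq_true_iff] at h; exact Or.inl h.2
      · exact Or.inr h
  have hUx := (hU x f hxf).2 hUf
  rcases hUx with ⟨-, h⟩ | ⟨h, -⟩
  · exact h
  · exact absurd h hx

/-- From the deleted glue back to the glue with the right pattern isolated at `b`. [folklore] -/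
theorem ipJunction_of_flagReachDel_right {b j : Fin (m + 1)} {Q Q' : ColPattern m} (h : flagReachDel b Q Q' j) :
    ipJunction m j Q (cpIsolate b Q') = true := by
  obtain ⟨f, hfb, hf, hfl⟩ := h
  rw [ipJunction_eq_true_iff]
  refine ⟨f, eqvGen_le_eqvGen (fun x y hxy => EqvGen.rel _ _ ?_) _ _ hf, ?_⟩
  · obtain ⟨hxb, hyb, h | h⟩ := hxy
    · exact Or.inl h
    · exact Or.inr ((cpIsolate_fst_eq_true_iff b Q' x y).2 (Or.inr ⟨hxb, hyb, h⟩))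
  · rcases hfl with h | h
    · exact Or.inl h
    · exact Or.inr ((cpIsolate_snd_eq_true_iff b Q' f).2 ⟨hfb, h⟩)

/-- **Isolations of an unmarked site are self-adjoint for the junction**:
`J(iso_b Q, Q') = J(Q, iso_b Q')` for valid patterns and `b ≠ j`. [cite: IkhlefPonsaing2012, Prop. 4.1] -/
theorem ipJunction_cpIsolate_left_eq_right {j b : Fin (m + 1)} (hbj : b ≠ j) {Q Q' : ColPattern m}
    (hQ : IsValid 0 Q) (hQ' : IsValid 0 Q') : ipJunction m j (cpIsolate b Q) Q' = ipJunction m j Q (cpIsolate b Q') := by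
  have key : ∀ {Q Q' : ColPattern m}, IsValid 0 Q' →
      ipJunction m j (cpIsolate b Q) Q' = true → ipJunction m j Q (cpIsolate b Q') = true := by
    intro Q Q' hQ' h
    rw [ipJunction_eq_true_iff] at h
    obtain ⟨f, hf, hfl⟩ := h
    exact ipJunction_of_flagReachDel_right (flagReach_cpIsolate_left hQ' hf hfl (Ne.symm hbj))
  rw [Bool.eq_iff_iff]
  constructor
  · exact key hQ'
  · intro h
    rw [ipJunction_symm] at h ⊢
    exact key hQ h

end Isolate

/-! ### Self-adjointness of the lumped moves in fibre-sum form -/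

section Adjoint

variable {K : Type*} [CommRing K]

/-- **`⟨e u, v⟩_J = ⟨u, e v⟩_J`** for a move `g` with `J(lump (g Q), Q') = J(Q, lump (g Q'))` on the
supports. [folklore] -/
theorem sum_pushforward_junction_comm (j : Fin (m + 1)) (g : ColPattern m → ColPattern m)
    (u v : ColPattern m → K)
    (hadj : ∀ Q Q', u Q ≠ 0 → v Q' ≠ 0 → ipJunction m j (lump (g Q)) Q' = ipJunction m j Q (lump (g Q'))) :
    ∑ Q, ∑ Q', (∑ Q₀ ∈ univ.filter (fun Q₀ => lump (g Q₀) = Q), u Q₀) * v Q' *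
        (if ipJunction m j Q Q' = true then 1 else 0) =
      ∑ Q, ∑ Q', u Q * (∑ Q₀ ∈ univ.filter (fun Q₀ => lump (g Q₀) = Q'), v Q₀) *
        (if ipJunction m j Q Q' = true then 1 else 0) := by
  classical
  -- both sides equal `Σ_{Q₀, Q₀'} u Q₀ v Q₀' [J(lump (g Q₀), Q₀')]` resp. `[J(Q₀, lump (g Q₀'))]`
  have hL : ∑ Q, ∑ Q', (∑ Q₀ ∈ univ.filter (fun Q₀ => lump (g Q₀) = Q), u Q₀) * v Q' *
      (if ipJunction m j Q Q' = true then 1 else 0) =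
      ∑ Q₀, ∑ Q', u Q₀ * v Q' * (if ipJunction m j (lump (g Q₀)) Q' = true then 1 else 0) := by
    rw [Finset.sum_comm]
    conv_rhs => rw [Finset.sum_comm]
    refine Finset.sum_congr rfl fun Q' _ => ?_
    simp_rw [Finset.sum_mul]
    rw [← Finset.sum_fiberwise_of_maps_to (s := Finset.univ) (t := Finset.univ) (g := fun Q₀ => lump (g Q₀))
      (fun _ _ => Finset.mem_univ _) (fun Q₀ => u Q₀ * v Q' * if ipJunction m j (lump (g Q₀)) Q' = true then 1 else 0)]
    refine Finset.sum_congr rfl fun Q _ => Finset.sum_congr rfl fun Q₀ hQ₀ => ?_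
    rw [(Finset.mem_filter.1 hQ₀).2]
  have hR : ∑ Q, ∑ Q', u Q * (∑ Q₀ ∈ univ.filter (fun Q₀ => lump (g Q₀) = Q'), v Q₀) *
      (if ipJunction m j Q Q' = true then 1 else 0) =
      ∑ Q, ∑ Q₀, u Q * v Q₀ * (if ipJunction m j Q (lump (g Q₀)) = true then 1 else 0) := by
    refine Finset.sum_congr rfl fun Q _ => ?_
    simp_rw [Finset.mul_sum, Finset.sum_mul]
    rw [← Finset.sum_fiberwise_of_maps_to (s := Finset.univ) (t := Finset.univ) (g := fun Q₀ => lump (g Q₀))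
      (fun _ _ => Finset.mem_univ _) (fun Q₀ => u Q * v Q₀ * if ipJunction m j Q (lump (g Q₀)) = true then 1 else 0)]
    refine Finset.sum_congr rfl fun Q' _ => Finset.sum_congr rfl fun Q₀ hQ₀ => ?_
    rw [(Finset.mem_filter.1 hQ₀).2]
  rw [hL, hR]
  refine Finset.sum_congr rfl fun Q _ => Finset.sum_congr rfl fun Q' _ => ?_
  by_cases hu : u Q = 0
  · simp [hu]
  by_cases hv : v Q' = 0
  · simp [hv]
  rw [hadj Q Q' hu hv]

end Adjoint

end Literature.Probability.Percolation
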